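import Summits.CriticalPhenomena.Ising3DConformalLimit.Theses.UnitLightCone
import Summits.CriticalPhenomena.Ising3DConformalLimit.Theorems.HyperoctahedralRPTwoPointLimitIsotropicHolds
import HarnessLib
import HarnessLib.Audit.Check

/-!
# Birth skeleton (BC3) of crux `UnitSpeedTwoPoint` — route UnitLightCone, item stmt-CriticalPhenomena-17167

Line `birth` = the PROVABLE-NOW reading of the crux recorded by its grounder (2026-08-16T23:03Z:
"K = C‖x‖^{-2Δ} by in-tree isotropy + homogeneity; explicit unit-cone KL measure via Sommerfeld's
integral + Γ-integral") and by the route review (refuter, 2026-08-16T23:31Z: "true if the conjecture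
is: KL of C|x|^{-2Δ} has ω = √(k² + m²) ≥ |k|"), with the Ising-specific content taken from LANDED tree
theorems inside the composition, so that the two registered stubs are model-blind classical analysis:

* TREE INPUT (sorry-free, imported): for every non-degenerate, translation-invariant, scale-covariant
  pointwise scaling limit `S` of `criticalCorr 3` (renormalisation `ρ > 0` on `(0,1]`) the kernel
  `K x = S 2 (0, x)` has `1/2 ≤ Δ ≤ 1`, is positive off `0` and homogeneous of degree `-2Δ`
  (`HyperoctahedralRPTwoPoint.twoPointKernelOfLimit_proof`, item stmt-1983) and is `O(3)`-invariant
  (`HyperoctahedralRPTwoPoint.kernel_rotation_invariant`, milestone stmt-1984 = `HRP2Rigidity_of ∘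
  twoPointKernelOfLimit_proof`, route HyperoctahedralRP; this landing is kill criterion (iv) of route
  UnitLightCone: the present crux no longer gates clause (ii) at `n = 2`, but it stays TRUE and is
  closed by this line).
* `stub_radialProfile` (S, pure Mathlib; registered VERBATIM as stub S1 of the sibling skeleton
  `Cruxes/LimitOrthantTP2/Lines/birth.lean`, so one landing serves both cruxes) — a `(-2Δ)`-homogeneous
  kernel on `ℝ³` invariant under every linear isometry off `0` is `C ‖x‖^{-2Δ}` off `0`
  (`x = ‖x‖ • u`, `K u = K e₀` by the reflection `Submodule.reflection_sub` exchanging two unit vectors).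
* `stub_unitConeKLPowerLaw` (M–L, classical analysis; the load-bearing stub) — for `1/2 ≤ Δ ≤ 1` and
  `C > 0` the kernel `C (a² + b² + t²)^{-Δ}` has a Källén–Lehmann / mixed spectral representation
  `= ∫ cos(k₀ a + k₁ b) e^{-ω|t|} dμ(k, ω)` (`t ≠ 0`) by a positive measure `μ` on `ℝ² × ℝ` giving zero
  mass to the spacelike region `{ω < |k|}`.  Pen proof: the Sommerfeld–Weyl identity
  `e^{-mr}/r = (2π)⁻¹ ∫_{ℝ²} cos(k·w) e^{-Ω|t|} Ω⁻¹ d²k`, `Ω = √(|k|² + m²) ≥ |k|`, `r² = |w|² + t²`,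
  valid for every `m ≥ 0`, `t ≠ 0` (the `p₃`-integral of `e^{ip·x}/(p² + m²)`); `Δ = 1/2`: `m = 0`,
  `μ` = image of `C (2π|k|)⁻¹ d²k` on the cone `ω = |k|`; `Δ > 1/2`:
  `r^{-2Δ} = Γ(2Δ-1)⁻¹ ∫₀^∞ m^{2Δ-2} e^{-mr} r⁻¹ dm`, so `μ` = image of
  `C Γ(2Δ-1)⁻¹ m^{2Δ-2} (2πΩ)⁻¹ d²k dm` under `(k, m) ↦ (k, Ω)`; the integrand is absolutely integrable
  for `t ≠ 0` (total mass against `e^{-ω|t|}` is `C|t|^{-2Δ}`), so the Bochner integral is honest.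
  `Δ ≥ 1/2` is exactly the unitarity bound `(d-2)/2` in `d = 3`: below it `r^{-2Δ}` is not reflection
  positive and no such `μ` exists — the tree's window is what makes the stub true.  References:
  Glimm–Jaffe 1987 §6.2 (KL representation); Watson, *Bessel functions* §13.47 (Sommerfeld's
  integral); Fröhlich–Israel–Lieb–Simon 1978; Berg–Christensen–Ressel 1984.

Composition `UnitSpeedTwoPoint_of : __Registered.stub_radialProfile →
__Registered.stub_unitConeKLPowerLaw → Theses.UnitLightCone.UnitSpeedTwoPoint` (sorry-free): tree input
+ S1 give `K = C ‖x‖^{-2Δ}` off `0`, `C > 0` from `K e₂ > 0`; S2 gives ONE unit-cone measure `μ` for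
`C (a²+b²+t²)^{-Δ}`, which serves both frames because `K` is radial — the axis-frame point
`a e₀ + b e₁ + t e₂` has `‖·‖² = a² + b² + t²` and the face-diagonal point
`((t+u)/√2) e₀ + ((t-u)/√2) e₁ + v e₂` has `‖·‖² = u² + v² + t²` (`norm_rpow_neg_two_mul`).  A final
`example` applies it to the two `stub_…` (checks that statements, aliases and stubs agree; an
`example`, so no sorry-tainted witness of the crux enters the environment).  Device `__Registered` as
in the sibling birth skeletons: hypotheses of `_of` are admissible BY NAME for `#h21_check_skeleton`.

Transfer: the crux (KL representations of the Ising limit kernel in two lattice frames) is moved to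
`C⁺ := UnitConeKLPowerLaw` (KL representation of the EXPLICIT conformal kernel), which is easier
because it is a closed-form computation (Sommerfeld–Weyl + Γ-mixture) with no lattice or limit in it;
the move is licensed by the landed isotropy theorem.  Relation to the route's own TWO-LAYER PLAN
(`UnitSpeedTwoPoint ⇐ LatticeSpectralEdge → EdgePassesToLimit`, the lattice spectral edge
`m(k) ≥ (1-o(1))|k|`, open): that line stays available; this file registers the closeable one.

Disproof used: none — `ledger crux ls stmt-CriticalPhenomena-17167` listed no workfiles before this one
(no `Disproof.lean`, no landed `Theorems/UnitSpeedTwoPoint/Negative/*`, 2026-08-17); the negatives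
index of the summit (11 refuted statements: Cardy / percolation / SAW items) has no Källén–Lehmann or
Ising-scaling-limit statement.
-/

noncomputable section

namespace Summit.CriticalPhenomena.Ising3DConformalLimit.Cruxes.UnitSpeedTwoPoint.Birth

open MeasureTheory
open Literature.Probability.LatticeModels

/-! ### The registered stubs (the only `sorry`s of the file) -/

/-- STUB S1 (S, pure Mathlib, provable now; verbatim the sibling stub
`Cruxes/LimitOrthantTP2/Lines/birth.lean : stub_radialProfile`) — a `(-2Δ)`-homogeneous kernel on `ℝ³`
invariant under every linear isometry off the origin is a power law `C ‖x‖^{-2Δ}` off the origin: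
`x = ‖x‖ • u` with `‖u‖ = 1`, homogeneity gives `K x = ‖x‖^{-2Δ} K u`, and `K u = K e₀` for a fixed unit
vector because two unit vectors are exchanged by the reflection in `(ℝ ∙ (u - e₀))ᗮ`
(`Submodule.reflection_sub`); `C := K e₀`.  Why it might fail: it does not (folklore; Schoenberg 1951). -/
theorem stub_radialProfile :
    ∀ (Δ : ℝ) (K : EuclideanSpace ℝ (Fin 3) → ℝ),
      (∀ c : ℝ, 0 < c → ∀ x, K (c • x) = c ^ (-(2 * Δ)) * K x) →
      (∀ (R : EuclideanSpace ℝ (Fin 3) ≃ₗᵢ[ℝ] EuclideanSpace ℝ (Fin 3)) (x : EuclideanSpace ℝ (Fin 3)),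
        x ≠ 0 → K (R x) = K x) →
      ∃ C : ℝ, ∀ x : EuclideanSpace ℝ (Fin 3), x ≠ 0 → K x = C * ‖x‖ ^ (-(2 * Δ)) := by
  sorry

/-- STUB S2 (M–L, classical analysis, the load-bearing stub) — `UnitConeKLPowerLaw`: for
`1/2 ≤ Δ ≤ 1` and `C > 0` there is a positive measure `μ` on `ℝ² × ℝ` with `μ {ω < |k|} = 0` and
`C (a² + b² + t²)^{-Δ} = ∫ cos(k₀ a + k₁ b) e^{-ω|t|} dμ` for all real `a b` and `t ≠ 0` (unit-cone
Källén–Lehmann representation of the conformal scalar two-point function of dimension `Δ` in `d = 3`,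
transverse momentum `k ∈ ℝ²`, energy `ω`).  Proof sketch: Sommerfeld–Weyl identity
`e^{-mr}/r = (2π)⁻¹ ∫ cos(k·w) e^{-Ω|t|} Ω⁻¹ d²k`, `Ω = √(|k|² + m²)`, for `m ≥ 0`; `Δ = 1/2` is `m = 0`;
`Δ > 1/2` by the Γ-mixture `r^{-2Δ} = Γ(2Δ-1)⁻¹ ∫₀^∞ m^{2Δ-2} e^{-mr} r⁻¹ dm`; `μ` is the image measure
under `(k, m) ↦ (k, Ω)`, carried by `{ω ≥ |k|}`; Tonelli/Fubini for `t ≠ 0`.  Sources: Glimm–Jaffe 1987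
§6.2; Watson §13.47; Berg–Christensen–Ressel 1984.  Why it might fail: it does not for `Δ ≥ 1/2`
(pen proof above; `Δ < 1/2` would violate reflection positivity); the cost is formalising the 2D
Fourier transform of the Yukawa potential. -/
theorem stub_unitConeKLPowerLaw :
    ∀ (Δ C : ℝ), 1/2 ≤ Δ → Δ ≤ 1 → 0 < C →
      ∃ μ : MeasureTheory.Measure (EuclideanSpace ℝ (Fin 2) × ℝ),
        μ {p : EuclideanSpace ℝ (Fin 2) × ℝ | p.2 < ‖p.1‖} = 0 ∧
        ∀ t a b : ℝ, t ≠ 0 →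
          C * (a ^ 2 + b ^ 2 + t ^ 2) ^ (-Δ) =
            ∫ p, Real.cos (p.1 0 * a + p.1 1 * b) * Real.exp (-(p.2 * |t|)) ∂μ := by
  sorry

/-! ### The two stub statements BY NAME — the hypotheses of `UnitSpeedTwoPoint_of`

`#h21_check_skeleton` admits a hypothesis of the composing theorem only if its head constant is a
registered obligation or is NAMED like a declared stub; so each `stub_X : <signature> := by sorry`
above is mirrored by `abbrev __Registered.stub_X : Prop := <the same signature, verbatim>`. -/
namespace __Registered

/-- Alias of the statement of the registered stub `stub_radialProfile` (S1), keyed by its name. -/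
abbrev stub_radialProfile : Prop :=
    ∀ (Δ : ℝ) (K : EuclideanSpace ℝ (Fin 3) → ℝ),
      (∀ c : ℝ, 0 < c → ∀ x, K (c • x) = c ^ (-(2 * Δ)) * K x) →
      (∀ (R : EuclideanSpace ℝ (Fin 3) ≃ₗᵢ[ℝ] EuclideanSpace ℝ (Fin 3)) (x : EuclideanSpace ℝ (Fin 3)),
        x ≠ 0 → K (R x) = K x) →
      ∃ C : ℝ, ∀ x : EuclideanSpace ℝ (Fin 3), x ≠ 0 → K x = C * ‖x‖ ^ (-(2 * Δ))

/-- Alias of the statement of the registered stub `stub_unitConeKLPowerLaw` (S2), keyed by its name. -/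
abbrev stub_unitConeKLPowerLaw : Prop :=
    ∀ (Δ C : ℝ), 1/2 ≤ Δ → Δ ≤ 1 → 0 < C →
      ∃ μ : MeasureTheory.Measure (EuclideanSpace ℝ (Fin 2) × ℝ),
        μ {p : EuclideanSpace ℝ (Fin 2) × ℝ | p.2 < ‖p.1‖} = 0 ∧
        ∀ t a b : ℝ, t ≠ 0 →
          C * (a ^ 2 + b ^ 2 + t ^ 2) ^ (-Δ) =
            ∫ p, Real.cos (p.1 0 * a + p.1 1 * b) * Real.exp (-(p.2 * |t|)) ∂μ

end __Registered

/-! ### Elementary geometry of the two frames (sorry-free glue) -/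

/-- `‖x‖² = x₀² + x₁² + x₂²` on `ℝ³`. -/
theorem norm_sq_three (x : EuclideanSpace ℝ (Fin 3)) : ‖x‖ ^ 2 = x 0 ^ 2 + x 1 ^ 2 + x 2 ^ 2 := by
  rw [EuclideanSpace.norm_eq, Real.sq_sqrt (by positivity), Fin.sum_univ_three]
  simp only [Real.norm_eq_abs, sq_abs]

/-- `‖x‖^{-2Δ} = (x₀² + x₁² + x₂²)^{-Δ}` on `ℝ³` (real powers). -/
theorem norm_rpow_neg_two_mul (x : EuclideanSpace ℝ (Fin 3)) (Δ : ℝ) :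
    ‖x‖ ^ (-(2 * Δ)) = (x 0 ^ 2 + x 1 ^ 2 + x 2 ^ 2) ^ (-Δ) := by
  have h : ‖x‖ = Real.sqrt (x 0 ^ 2 + x 1 ^ 2 + x 2 ^ 2) := by
    rw [← norm_sq_three, Real.sqrt_sq (norm_nonneg _)]
  rw [h, Real.sqrt_eq_rpow, ← Real.rpow_mul (by positivity)]
  congr 1
  ring

/-! ### The composition (kernel-checked, no `sorry`) -/

/-- **`UnitSpeedTwoPoint` from the two stubs and the tree.**  For an admissible limit `(ρ, Δ, S)`:
the kernel `K x = S 2 (0, x)` has `1/2 ≤ Δ ≤ 1`, `K > 0` off `0`, homogeneity `-2Δ`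
(`twoPointKernelOfLimit_proof`) and `O(3)`-invariance (`kernel_rotation_invariant`), all LANDED; S1
makes it `C ‖x‖^{-2Δ}` off `0`, and `C > 0` because `K e₂ > 0`; S2 at `(Δ, C)` gives one unit-cone
measure `μ`; the axis frame is S2 at `(t, a, b)` and the face-diagonal frame is S2 at `(t, u, v)`
since `((t+u)/√2)² + ((t-u)/√2)² + v² = u² + v² + t²`. -/
theorem UnitSpeedTwoPoint_of (hA : __Registered.stub_radialProfile)
    (hB : __Registered.stub_unitConeKLPowerLaw) :
    Summit.CriticalPhenomena.Ising3DConformalLimit.Theses.UnitLightCone.UnitSpeedTwoPoint := by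
  intro ρ Δ S hρ hlim _hnorm hnd htr hsc
  -- tree input: window, positivity, homogeneity (item 1983) and O(3)-invariance (milestone 1984)
  obtain ⟨⟨hΔ1, hΔ2⟩, _hcont, hpos, hhom, _hmirror⟩ :=
    Summit.CriticalPhenomena.Ising3DConformalLimit.HyperoctahedralRPTwoPoint.twoPointKernelOfLimit_proof
      ρ Δ S hρ hlim hnd htr hsc
  have hinv : ∀ (R : EuclideanSpace ℝ (Fin 3) ≃ₗᵢ[ℝ] EuclideanSpace ℝ (Fin 3))
      (x : EuclideanSpace ℝ (Fin 3)), x ≠ 0 →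
      (fun q : EuclideanSpace ℝ (Fin 3) => S 2 ![0, q]) (R x) = (fun q => S 2 ![0, q]) x :=
    fun R x _ =>
      Summit.CriticalPhenomena.Ising3DConformalLimit.HyperoctahedralRPTwoPoint.kernel_rotation_invariant
        hρ hlim hnd htr hsc R x
  -- S1: the kernel is a power law off the origin
  obtain ⟨C, hC⟩ := hA Δ (fun q => S 2 ![0, q]) hhom hinv
  have hK : ∀ x : EuclideanSpace ℝ (Fin 3), x ≠ 0 → S 2 ![0, x] = C * ‖x‖ ^ (-(2 * Δ)) :=
    fun x hx => hC x hx
  -- C > 0 from K e₂ > 0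
  have hCpos : 0 < C := by
    have he : (EuclideanSpace.single 2 (1:ℝ) : EuclideanSpace ℝ (Fin 3)) ≠ 0 := by
      intro h
      have h2 : (EuclideanSpace.single 2 (1:ℝ) : EuclideanSpace ℝ (Fin 3)) 2 = 0 := by rw [h]; rfl
      simp at h2
    have h1 := hpos _ he
    rw [hK _ he] at h1
    exact pos_of_mul_pos_left h1 (Real.rpow_nonneg (norm_nonneg _) _)
  -- S2: one unit-cone measure for the explicit kernel
  obtain ⟨μ, hμ0, hμ⟩ := hB Δ C hΔ1 hΔ2 hCpos
  refine ⟨⟨μ, hμ0, fun t a b ht => ?_⟩, ⟨μ, hμ0, fun t u v ht => ?_⟩⟩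
  · -- axis frame `e₂`: the point `a e₀ + b e₁ + t e₂`
    set p : EuclideanSpace ℝ (Fin 3) :=
      EuclideanSpace.single 0 a + EuclideanSpace.single 1 b + EuclideanSpace.single 2 t with hp
    have h0 : p 0 = a := by simp [hp]
    have h1 : p 1 = b := by simp [hp]
    have h2 : p 2 = t := by simp [hp]
    have hp0 : p ≠ 0 := by
      intro h
      apply ht
      rw [← h2, h]
      rfl
    show S 2 ![0, p] = _
    rw [hK p hp0, norm_rpow_neg_two_mul, h0, h1, h2]
    exact hμ t a b ht
  · -- face-diagonal frame `(e₀ + e₁)/√2`: the point `((t+u)/√2) e₀ + ((t-u)/√2) e₁ + v e₂`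
    set q : EuclideanSpace ℝ (Fin 3) :=
      EuclideanSpace.single 0 ((t + u) / Real.sqrt 2) + EuclideanSpace.single 1 ((t - u) / Real.sqrt 2) +
        EuclideanSpace.single 2 v with hq
    have h0 : q 0 = (t + u) / Real.sqrt 2 := by simp [hq]
    have h1 : q 1 = (t - u) / Real.sqrt 2 := by simp [hq]
    have h2 : q 2 = v := by simp [hq]
    have hs : Real.sqrt 2 ≠ 0 := by positivity
    have hq0 : q ≠ 0 := by
      intro h
      have e0 : (t + u) / Real.sqrt 2 = 0 := by rw [← h0, h]; rfl
      have e1 : (t - u) / Real.sqrt 2 = 0 := by rw [← h1, h]; rfl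
      rw [div_eq_zero_iff, or_iff_left hs] at e0 e1
      exact ht (by linarith)
    have hsum : q 0 ^ 2 + q 1 ^ 2 + q 2 ^ 2 = u ^ 2 + v ^ 2 + t ^ 2 := by
      rw [h0, h1, h2, div_pow, div_pow, Real.sq_sqrt (by norm_num : (0:ℝ) ≤ 2)]
      ring
    show S 2 ![0, q] = _
    rw [hK q hq0, norm_rpow_neg_two_mul, hsum]
    exact hμ t u v ht

/-- The registered stubs discharge the hypotheses of `UnitSpeedTwoPoint_of` verbatim (an `example`, so
no pre-composed sorry-tainted witness of the crux enters the environment; its only `sorry`s are the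
stubs'). -/
example : Summit.CriticalPhenomena.Ising3DConformalLimit.Theses.UnitLightCone.UnitSpeedTwoPoint :=
  UnitSpeedTwoPoint_of stub_radialProfile stub_unitConeKLPowerLaw

end Summit.CriticalPhenomena.Ising3DConformalLimit.Cruxes.UnitSpeedTwoPoint.Birth

end

#h21_check_skeleton "stmt-CriticalPhenomena-17167" Summit.CriticalPhenomena.Ising3DConformalLimit.Theses.UnitLightCone.UnitSpeedTwoPoint stub_radialProfile stub_unitConeKLPowerLaw
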